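import Summits.Ventures.PercRepro2.FourFunctions
import Summits.Ventures.PercRepro2.CaseOneStarCells

/-!
# The sister gadgets' missing cell fact `hB1` and its provable half
(blind cell PercRepro2, p1 g35; S5 §2.3 (i), P1-G35 §6)

The base-cone certificates of the sister gadgets `uwb` / `uwa1b` need ONE cell inequality beyond
`SFacts` (kit j328796, 290 / 290 at degree 3): `hB1 : c₁ · c₁₀ ≤ c₉ · c₄` in the status cells of
`CaseOneStarCells` — `P(b ∈ C₁, o ∉ U) · P(o ↔ b, o, b ∉ U) ≤ P(o, b ∉ U, o ↮ b) · P(o ∈ C₁, b ∈ C₁)`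
under `a₁ ↮ a₂`. This file records the statement (`HB1`, a `Prop`, NOT a theorem — census-true on
1,000 exact bases and every climb to 8 vertices, open) and PROVES its one-root form (`oneRoot_four_cell`) and its weak two-root form by the four functions
theorem: `c₁ · c₁₀ ≤ P(o, b ∈ C(a₁)) · c₉` (`cellMass_one_mul_ten_le`) — the join of a cell-1 and a
cell-10 configuration has `b ∈ C(a₁)` and `o ↔ b`, hence `o ∈ C(a₁)`, and the meet is in cell 9
(`a₁ ↮ a₂` is decreasing, every «outside» status is inherited). The gap between the weak form and
`hB1` is exactly the term `P(o, b ∈ C(a₁), a₁ ↔ a₂)` that the join may create. Standard axioms. -/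

namespace Summit.Ventures.PercRepro2

namespace CaseOne

section HB1Cells
variable {V : Type*} {E : Type*}

/-- The statuses are `0`, `1` or `2`. -/
lemma status_cases (ends : E → Sym2 V) (ω : Config E) (a₁ a₂ v : V) :
    status ends ω a₁ a₂ v = 0 ∨ status ends ω a₁ a₂ v = 1 ∨ status ends ω a₁ a₂ v = 2 := by
  unfold status
  split_ifs <;> simp

/-- Status `1` means `v ∈ C(a₁)`. -/
lemma conn_a1_of_status_eq_one {ends : E → Sym2 V} {ω : Config E} {a₁ a₂ v : V}
    (h : status ends ω a₁ a₂ v = 1) : Conn ends ω a₁ v := by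
  unfold status at h
  by_cases h1 : Conn ends ω a₁ v
  · exact h1
  · rw [if_neg h1] at h
    by_cases h2 : Conn ends ω a₂ v
    · rw [if_pos h2] at h; norm_num at h
    · rw [if_neg h2] at h; norm_num at h

/-- Status `0` means `v ∉ C(a₁) ∪ C(a₂)`. -/
lemma status_eq_zero_iff {ends : E → Sym2 V} {ω : Config E} {a₁ a₂ v : V} :
    status ends ω a₁ a₂ v = 0 ↔ ¬ Conn ends ω a₁ v ∧ ¬ Conn ends ω a₂ v := by
  unfold status
  by_cases h1 : Conn ends ω a₁ v
  · simp [h1]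
  · by_cases h2 : Conn ends ω a₂ v
    · simp [h1, h2]
    · simp [h1, h2]

/-- Cell `1` unpacked: `a₁ ↮ a₂`, `b ∈ C(a₁)`, `o ∉ C(a₁) ∪ C(a₂)`. -/
lemma of_cellIdx_eq_one {ends : E → Sym2 V} {ω : Config E} {o a₁ a₂ b : V}
    (h : cellIdx ends ω o a₁ a₂ b = 1) :
    ¬ Conn ends ω a₁ a₂ ∧ Conn ends ω a₁ b ∧ ¬ Conn ends ω a₁ o ∧ ¬ Conn ends ω a₂ o := by
  unfold cellIdx at h
  by_cases hQ : Conn ends ω a₁ a₂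
  · rw [if_pos hQ] at h; norm_num at h
  rw [if_neg hQ] at h
  by_cases hz : status ends ω a₁ a₂ o = 0 ∧ status ends ω a₁ a₂ b = 0
  · rw [if_pos hz] at h
    by_cases hob : Conn ends ω o b
    · rw [if_pos hob] at h; norm_num at h
    · rw [if_neg hob] at h; norm_num at h
  rw [if_neg hz] at h
  rcases status_cases ends ω a₁ a₂ o with ho | ho | ho <;>
    rcases status_cases ends ω a₁ a₂ b with hb | hb | hb <;> rw [ho, hb] at h <;> norm_num at h
  exact ⟨hQ, conn_a1_of_status_eq_one hb, (status_eq_zero_iff.1 ho).1, (status_eq_zero_iff.1 ho).2⟩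

/-- Cell `10` unpacked: `a₁ ↮ a₂`, `o, b ∉ C(a₁) ∪ C(a₂)`, `o ↔ b`. -/
lemma of_cellIdx_eq_ten {ends : E → Sym2 V} {ω : Config E} {o a₁ a₂ b : V}
    (h : cellIdx ends ω o a₁ a₂ b = 10) :
    ¬ Conn ends ω a₁ a₂ ∧ (¬ Conn ends ω a₁ o ∧ ¬ Conn ends ω a₂ o) ∧
      (¬ Conn ends ω a₁ b ∧ ¬ Conn ends ω a₂ b) ∧ Conn ends ω o b := by
  unfold cellIdx at h
  by_cases hQ : Conn ends ω a₁ a₂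
  · rw [if_pos hQ] at h; norm_num at h
  rw [if_neg hQ] at h
  by_cases hz : status ends ω a₁ a₂ o = 0 ∧ status ends ω a₁ a₂ b = 0
  · rw [if_pos hz] at h
    by_cases hob : Conn ends ω o b
    · exact ⟨hQ, status_eq_zero_iff.1 hz.1, status_eq_zero_iff.1 hz.2, hob⟩
    · rw [if_neg hob] at h; norm_num at h
  rw [if_neg hz] at h
  rcases status_cases ends ω a₁ a₂ o with ho | ho | ho <;>
    rcases status_cases ends ω a₁ a₂ b with hb | hb | hb <;> rw [ho, hb] at h <;> norm_num at h

/-- Cell `9` assembled: `a₁ ↮ a₂`, `o, b ∉ C(a₁) ∪ C(a₂)`, `o ↮ b`. -/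
lemma cellIdx_eq_nine {ends : E → Sym2 V} {ω : Config E} {o a₁ a₂ b : V}
    (hQ : ¬ Conn ends ω a₁ a₂) (ho1 : ¬ Conn ends ω a₁ o) (ho2 : ¬ Conn ends ω a₂ o)
    (hb1 : ¬ Conn ends ω a₁ b) (hb2 : ¬ Conn ends ω a₂ b) (hob : ¬ Conn ends ω o b) :
    cellIdx ends ω o a₁ a₂ b = 9 := by
  unfold cellIdx
  rw [if_neg hQ, if_pos ⟨status_eq_zero_iff.2 ⟨ho1, ho2⟩, status_eq_zero_iff.2 ⟨hb1, hb2⟩⟩, if_neg hob]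

end HB1Cells

section HB1
variable {V : Type*} {E : Type*} [Fintype E] [DecidableEq E]
  {R : Type*} [CommRing R] [LinearOrder R] [IsStrictOrderedRing R]

/-- **The missing cell fact `hB1`** (a statement, not a theorem): `c₁ · c₁₀ ≤ c₉ · c₄`. -/
def HB1 (p : E → R) (ends : E → Sym2 V) (o a₁ a₂ b : V) : Prop :=
  cellMass p ends o a₁ a₂ b 1 * cellMass p ends o a₁ a₂ b 10 ≤
    cellMass p ends o a₁ a₂ b 9 * cellMass p ends o a₁ a₂ b 4

/-- **The weak form of `hB1`** (Ahlswede–Daykin): `c₁ · c₁₀ ≤ P(o, b ∈ C(a₁)) · c₉` — the join of a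
cell-1 and a cell-10 configuration has `o, b ∈ C(a₁)` (possibly with `a₁ ↔ a₂`), the meet is in
cell 9. -/
theorem cellMass_one_mul_ten_le (p : E → R) (hp : IsProbVec p) (ends : E → Sym2 V) (o a₁ a₂ b : V) :
    cellMass p ends o a₁ a₂ b 1 * cellMass p ends o a₁ a₂ b 10 ≤
      prob p {ω | Conn ends ω a₁ o ∧ Conn ends ω a₁ b} * cellMass p ends o a₁ a₂ b 9 := by
  unfold cellMass
  refine prob_mul_prob_le_of_sup_inf hp fun ω hω ω' hω' => ?_
  obtain ⟨hQ, hb, ho1, ho2⟩ := of_cellIdx_eq_one hω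
  obtain ⟨_, ⟨_, _⟩, ⟨hb1', hb2'⟩, hob'⟩ := of_cellIdx_eq_ten hω'
  refine ⟨?_, ?_⟩
  · have h1 : Conn ends (ω ⊔ ω') a₁ b := conn_mono le_sup_left hb
    have h2 : Conn ends (ω ⊔ ω') o b := conn_mono le_sup_right hob'
    exact ⟨conn_trans h1 (conn_symm h2), h1⟩
  · show cellIdx ends (ω ⊓ ω') o a₁ a₂ b = 9
    exact cellIdx_eq_nine (fun h => hQ (conn_mono inf_le_left h))
      (fun h => ho1 (conn_mono inf_le_left h)) (fun h => ho2 (conn_mono inf_le_left h))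
      (fun h => hb1' (conn_mono inf_le_right h)) (fun h => hb2' (conn_mono inf_le_right h))
      (fun h => ho1 (conn_trans hb (conn_symm (conn_mono inf_le_left h))))

/-- **The one-root form of `hB1` is a theorem** (Ahlswede–Daykin, no conditioning): for one root `a`,
`P(b ∈ C(a), o ∉ C(a)) · P(o, b ∉ C(a), o ↔ b) ≤ P(o, b ∈ C(a)) · P(o, b ∉ C(a), o ↮ b)`. -/
theorem oneRoot_four_cell (p : E → R) (hp : IsProbVec p) (ends : E → Sym2 V) (o a b : V) :
    prob p {ω | Conn ends ω a b ∧ ¬ Conn ends ω a o} *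
        prob p {ω | ¬ Conn ends ω a o ∧ ¬ Conn ends ω a b ∧ Conn ends ω o b} ≤
      prob p {ω | Conn ends ω a o ∧ Conn ends ω a b} *
        prob p {ω | ¬ Conn ends ω a o ∧ ¬ Conn ends ω a b ∧ ¬ Conn ends ω o b} := by
  refine prob_mul_prob_le_of_sup_inf hp fun ω hω ω' hω' => ?_
  obtain ⟨hb, ho⟩ := hω
  obtain ⟨_, hb', hob'⟩ := hω'
  refine ⟨?_, ?_⟩
  · have h1 : Conn ends (ω ⊔ ω') a b := conn_mono le_sup_left hb
    have h2 : Conn ends (ω ⊔ ω') o b := conn_mono le_sup_right hob'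
    exact ⟨conn_trans h1 (conn_symm h2), h1⟩
  · exact ⟨fun h => ho (conn_mono inf_le_left h), fun h => hb' (conn_mono inf_le_right h),
      fun h => ho (conn_trans hb (conn_symm (conn_mono inf_le_left h)))⟩

end HB1

end CaseOne

end Summit.Ventures.PercRepro2
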